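import Literature.Probability.LatticeModels.CriticalTwoPointDCPLowerTorus
import Literature.Probability.LatticeModels.CriticalTwoPointDCPLowerLemma25
import Literature.Probability.LatticeModels.SharpLengthDCPFromReflected
import HarnessLib

/-!
# Duminil-Copin–Panis 2025, Theorem 1.2 in the near-critical range `β ≤ β_c`, `n ≤ L(β)`:
# the torus inequality with the sharp-length input, its infinite-volume limit, and Theorem 1.3

Topic `Literature/Probability/LatticeModels`; family `crit-ising`. Theorems only (no definition,
no named fact). This file is the near-critical twin of the tree's `β = β_c` route to
`dcp_reflectedGradient_lower` (`ReflectedCurrents.lean`, `TorusFoldable.lean`,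
`CriticalTwoPointDCPLowerTorus.lean`), written for the named fact
`dcp_twoPoint_axis_lower_nearCritical` (`SharpLengthDCP.lean`: Duminil-Copin–Panis, CMP 406
(2025), arXiv:2404.05700, **Theorem 1.3** for `0 ≤ β ≤ β_c`, `N₁ ≤ n`, `4n ≤ L(β)`), whose proof is
"Theorem 1.2 at scale `4n`" (`dcp_twoPoint_axis_lower_of_reflectedGradient_nearCritical`,
`SharpLengthDCPFromReflected.lean`) and therefore needs **Theorem 1.2 for `β ≤ β_c`,
`N₀ ≤ n ≤ L(β)`** — not only at `β_c`.

The printed proof of Theorem 1.2 (§2.2 of the source) is the same for all `β ≤ β_c`; the only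
place where the range `n ≤ L(β)` enters is the sentence before eq. (2.5): "By definition of
`L(β)`, if `0 ≤ n ≤ L(β)` and `S ⊂ Λ_n`, then `φ_β(S) ≥ 1/2`" applied to the random set
`𝒮_n ⊂ Λ_{n-1}`, with the paper's OWN boundary functional
`φ_β(S) = β Σ_{x ∈ S} Σ_{y ∉ S, y ∼ x} ⟨σ₀σ_x⟩_{S,β}` (Definition 1.1; the tree's `dcpPhi`) and the
threshold `1/2` — whereas the tree's `β_c` file feeds Duminil-Copin–Tassion's `Σ tanh β ⟨σ₀σ_x⟩_S ≥ 1`.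
Hence this file redoes the two `φ`-dependent steps of `CriticalTwoPointDCPLowerTorus.lean` for a
**general weight** `w ≥ 0` and the hypothesis `1 ≤ w Σ_{x ∈ S} #{y ∉ S : y ∼ x} ⟨σ₀σ_x⟩_S` for
`0 ∈ S ⊆ Λ_{n-1}` (near-critical: `w = 2β`; at `β_c` one may take `w = tanh β_c` as well):

* `DCPNearCritical.pointwise_master_weight` — eqs. (2.20)–(2.24) for one current configuration;
* `DCPNearCritical.torusIneq_of_lemma25_weight` — integration against the sourceless current of
  the even torus `(ℤ/Lℤ)^d`, Lemma 2.4 in current form (`IsFoldable.tsum_empty_connFix_le`) and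
  Lemma 2.5 as the per-pair hypothesis `H25` (verbatim the hypothesis of the tree's
  `DCPLower.torusIneq_of_lemma25`, so that the tree's proof of Lemma 2.5 discharges both);

and then carries out, for `0 ≤ β` with `m*(β) = 0` (all `β ≤ β_c`, `d ≥ 3`), the remaining
printed steps of §2.2:

* `DCPNearCritical.hle_torus` — `Z(0̄, θ_δx̄) ≤ Z(0̄, x̄)` for box points (the hypothesis `Hle`);
* the limit `L → ∞` along even tori ("We conclude by taking `Λ ↗ ℤ^d`", end of the proof of
  Lemma 2.5; here through `abs_isingTorusTwoPoint_sub_plusCorr_le_of_spontaneousMagnetization_eq_zero`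
  and `⟨σ_aσ_b⟩⁺ = ⟨σ_aσ_b⟩^∅ = ⟨σ₀σ_{b-a}⟩^∅` at `m*(β) = 0`);
* the symmetry reduction "Using a union bound and the symmetries of `𝐏^∅_β` … `= 2d 𝐏^∅_β[0 ∉ 𝒮_n(+e₁)]`"
  (proof of Lemma 2.4) and "Using the symmetries of `𝐏^∅_β` and (2.7)" (before Lemma 2.5): all
  `2d` directions contribute the same, by the hyperoctahedral invariance of `⟨σ₀σ_x⟩^∅_β`
  (`twoPointFree_signedPerm`);
* Lemma 2.4 proper: `⟨σ₀σ_{2ne₁}⟩_β ≤ C(2n)^{2-d} → 0` by the infrared bound for `β ≤ β_c`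
  (`twoPointFree_le_of_le_criticalBeta`);

which gives Theorem 1.2 in the near-critical range modulo `H25`, and — through the landed glue —
Theorem 1.3 (`dcp_twoPoint_axis_lower_nearCritical`) modulo `H25`.

## References

* H. Duminil-Copin, R. Panis, *New lower bounds for the (near) critical Ising and φ⁴ models'
  two-point functions*, Comm. Math. Phys. 406 (2025), arXiv:2404.05700, §2.2 (Lemmas 2.4–2.5,
  eqs. (2.5)–(2.8), (2.20)–(2.24)), Theorems 1.2–1.3 [DuminilCopinPanis2025LowerBounds]
  (held: `lit read arxiv:2404.05700`, chunks 5, 9–11).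
* S. Friedli, Y. Velenik, *Statistical Mechanics of Lattice Systems*, CUP 2017, §3.1, Exercises
  3.12, 3.14 [FriedliVelenik2017] (Griffiths monotonicity, lattice symmetries).
* M. Aizenman, H. Duminil-Copin, Ann. Math. 194 (2021), arXiv:1912.07973, Prop. 5.2
  [AizenmanDuminilCopinAnnals2021] (torus two-point functions converge when `m* = 0`), through
  `TorusTwoPointLimit.lean`.
-/

noncomputable section

open Finset Filter Topology

namespace Literature.Probability.LatticeModels

namespace DCPNearCritical

open DCPLower

variable {d : ℕ}

/-! ### The pointwise inequality (2.20)–(2.24) for a general weight -/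

/-- **The pointwise inequality behind Theorem 1.2, general weight** (Duminil-Copin–Panis 2025,
§2.2, from (2.20) to (2.24), for ONE current configuration, abstracted as in the tree's
`DCPLower.pointwise_master`): let `c_δ` (`δ = (i, ±)`, the `2d` directions) be predicates on the
box `Λ_n ⊂ ℤ^d` such that every face point `z_i = ±n` satisfies the corresponding `c_{(i,±)}`,
let `S = {z ∈ Λ_n : ¬c_δ(z) ∀ δ}` (so `S ⊆ Λ_{n-1}`) and `W_δ = {z ∈ Λ_n : ¬c_δ(z)}`, read in a
torus `(ℤ/Lℤ)^d`, `L > 2n + 1`. If for some weight `w ≥ 0` the boundary input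
`1 ≤ w Σ_{x ∈ S'} #{y ∉ S' : y ∼ x} ⟨σ₀σ_x⟩_{S'}` holds for every `S' ∋ 0` inside `Λ_{n-1}` — in
the near-critical range `n ≤ L(β)` this is "`φ_β(S') ≥ 1/2`" (sentence before eq. (2.5)) with
`w = 2β` — then
`1 ≤ Σ_δ 𝟙[c_δ 0] + w Σ_δ Σ_{x,y ∈ Λ_n, y ∼ x} 𝟙[¬c_δ 0, ¬c_δ x, c_δ y] ⟨σ_{0̄}σ_{x̄}⟩^∅_{W_δ}`:
either `0 ∉ S`, or the boundary input holds for `S` and each boundary term `⟨σ₀σ_x⟩_S` (`x ∈ S`,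
`y ∼ x`, `y ∉ S`, so `c_δ(y)` for some `δ`) is at most `⟨σ_{0̄}σ_{x̄}⟩_{W_δ}` by Griffiths'
monotonicity (`S ⊆ W_δ`). [cite: DuminilCopinPanis2025LowerBounds, §2.2, eqs. (2.5) and (2.20)–(2.24)] -/
theorem pointwise_master_weight {L : ℕ} [NeZero L] {n : ℕ} (hn : 1 ≤ n) (hnL : 2 * n + 1 < L) {β : ℝ} (hβ : 0 ≤ β)
    {w : ℝ} (hw : 0 ≤ w)
    (hφ : ∀ S : Finset (Site d), (0 : Site d) ∈ S → S ⊆ box d (n - 1) →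
      1 ≤ w * ∑ x ∈ S, ((((zdGraph d).neighborFinset x).filter fun y => y ∉ S).card : ℝ) *
        isingTwoPoint (zdGraph d) S β 0 .free 0 x)
    (c : Fin d × Bool → Site d → Prop) [∀ δ z, Decidable (c δ z)]
    (hface : ∀ z ∈ box d n, ∀ i : Fin d, (z i = n → c (i, true) z) ∧ (z i = -(n : ℤ) → c (i, false) z)) :
    (1 : ℝ) ≤ (∑ δ : Fin d × Bool, if c δ 0 then (1 : ℝ) else 0) +
      w * ∑ δ : Fin d × Bool, ∑ x ∈ box d n, ∑ y ∈ box d n,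
        if (zdGraph d).Adj x y ∧ ¬ c δ 0 ∧ ¬ c δ x ∧ c δ y then
          isingTwoPoint (torusGraph d L) (((box d n).filter fun z => ¬ c δ z).image (Torus.proj L)) β 0 .free
            (Torus.proj L 0) (Torus.proj L x)
        else 0 := by
  classical
  set W : Fin d × Bool → Finset (TorusSite d L) :=
    fun δ => ((box d n).filter fun z => ¬ c δ z).image (Torus.proj L) with hW
  have h0box : (0 : Site d) ∈ box d n := zero_mem_box d n
  have hmemW : ∀ {δ : Fin d × Bool} {z : Site d}, z ∈ box d n → ¬ c δ z → Torus.proj L z ∈ W δ :=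
    fun hz hc => mem_image.2 ⟨_, mem_filter.2 ⟨hz, hc⟩, rfl⟩
  -- every summand of the triple sum is nonnegative
  have hterm : ∀ δ, ∀ x ∈ box d n, ∀ y, 0 ≤ (if (zdGraph d).Adj x y ∧ ¬ c δ 0 ∧ ¬ c δ x ∧ c δ y then
      isingTwoPoint (torusGraph d L) (W δ) β 0 .free (Torus.proj L 0) (Torus.proj L x) else 0) := by
    intro δ x hx y
    split_ifs with h
    · exact isingTwoPoint_free_nonneg_of_mem _ hβ (hmemW h0box h.2.1) (hmemW hx h.2.2.1)
    · exact le_rfl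
  have htriple : 0 ≤ ∑ δ : Fin d × Bool, ∑ x ∈ box d n, ∑ y ∈ box d n,
      (if (zdGraph d).Adj x y ∧ ¬ c δ 0 ∧ ¬ c δ x ∧ c δ y then
        isingTwoPoint (torusGraph d L) (W δ) β 0 .free (Torus.proj L 0) (Torus.proj L x) else 0) :=
    sum_nonneg fun δ _ => sum_nonneg fun x hx => sum_nonneg fun y _ => hterm δ x hx y
  have hind : 0 ≤ ∑ δ : Fin d × Bool, (if c δ 0 then (1 : ℝ) else 0) :=
    sum_nonneg fun δ _ => by split_ifs <;> norm_num
  by_cases h0 : ∃ δ, c δ 0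
  · -- `0` is connected in some direction
    obtain ⟨δ₀, hδ₀⟩ := h0
    have h1 : (1 : ℝ) ≤ ∑ δ : Fin d × Bool, (if c δ 0 then (1 : ℝ) else 0) := by
      have := Finset.single_le_sum (f := fun δ : Fin d × Bool => if c δ 0 then (1 : ℝ) else 0)
        (fun δ _ => by split_ifs <;> norm_num) (mem_univ δ₀)
      simp only [if_pos hδ₀] at this
      exact this
    nlinarith [mul_nonneg hw htriple]
  · push Not at h0
    -- the random set `S`
    set S : Finset (Site d) := (box d n).filter fun z => ∀ δ, ¬ c δ z with hS
    have h0S : (0 : Site d) ∈ S := mem_filter.2 ⟨h0box, h0⟩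
    have hSbox : S ⊆ box d n := filter_subset _ _
    have hSpred : S ⊆ box d (n - 1) := by
      intro z hz
      obtain ⟨hzbox, hzc⟩ := mem_filter.1 hz
      refine mem_box_pred_of_forall_ne hzbox fun i => ⟨fun h => hzc (i, true) ((hface z hzbox i).1 h),
        fun h => hzc (i, false) ((hface z hzbox i).2 h)⟩
    have hSW : ∀ δ, S.image (Torus.proj L) ⊆ W δ := by
      intro δ v hv
      obtain ⟨z, hz, rfl⟩ := mem_image.1 hv
      obtain ⟨hzbox, hzc⟩ := mem_filter.1 hz
      exact hmemW hzbox (hzc δ)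
    have hφS := hφ S h0S hSpred
    -- termwise bound
    have hA : ∀ x ∈ S, ∀ y ∈ ((zdGraph d).neighborFinset x).filter (fun y => y ∉ S),
        isingTwoPoint (zdGraph d) S β 0 .free 0 x ≤
          ∑ δ : Fin d × Bool,
            (if (zdGraph d).Adj x y ∧ ¬ c δ 0 ∧ ¬ c δ x ∧ c δ y then
              isingTwoPoint (torusGraph d L) (W δ) β 0 .free (Torus.proj L 0) (Torus.proj L x) else 0) := by
      intro x hx y hy
      obtain ⟨hyadj, hyS⟩ := mem_filter.1 hy
      rw [SimpleGraph.mem_neighborFinset] at hyadj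
      have hybox : y ∈ box d n := mem_box_of_adj_of_mem_box_pred hn (hSpred hx) hyadj
      have hyc : ∃ δ, c δ y := by
        by_contra hne
        push Not at hne
        exact hyS (mem_filter.2 ⟨hybox, hne⟩)
      obtain ⟨δ₁, hδ₁⟩ := hyc
      obtain ⟨hxbox, hxc⟩ := mem_filter.1 hx
      have hcond : (zdGraph d).Adj x y ∧ ¬ c δ₁ 0 ∧ ¬ c δ₁ x ∧ c δ₁ y := ⟨hyadj, h0 δ₁, hxc δ₁, hδ₁⟩
      -- `⟨σ₀σ_x⟩_S` (in `ℤ^d`) `= ⟨σ_{0̄}σ_{x̄}⟩_{S̄}` (torus) `≤ ⟨σ_{0̄}σ_{x̄}⟩_{W_{δ₁}}`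
      have htrans : isingTwoPoint (zdGraph d) S β 0 .free 0 x ≤
          isingTwoPoint (torusGraph d L) (W δ₁) β 0 .free (Torus.proj L 0) (Torus.proj L x) := by
        rw [Torus.isingTwoPoint_free_eq_torus hnL hSbox β h0S hx]
        exact isingTwoPoint_free_le_of_subset _ hβ (hSW δ₁) (mem_image_of_mem _ h0S) (mem_image_of_mem _ hx)
      calc isingTwoPoint (zdGraph d) S β 0 .free 0 x
          ≤ (if (zdGraph d).Adj x y ∧ ¬ c δ₁ 0 ∧ ¬ c δ₁ x ∧ c δ₁ y then
              isingTwoPoint (torusGraph d L) (W δ₁) β 0 .free (Torus.proj L 0) (Torus.proj L x) else 0) := by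
            rw [if_pos hcond]
            exact htrans
        _ ≤ ∑ δ : Fin d × Bool,
            (if (zdGraph d).Adj x y ∧ ¬ c δ 0 ∧ ¬ c δ x ∧ c δ y then
              isingTwoPoint (torusGraph d L) (W δ) β 0 .free (Torus.proj L 0) (Torus.proj L x) else 0) :=
            Finset.single_le_sum (f := fun δ : Fin d × Bool =>
              (if (zdGraph d).Adj x y ∧ ¬ c δ 0 ∧ ¬ c δ x ∧ c δ y then
                isingTwoPoint (torusGraph d L) (W δ) β 0 .free (Torus.proj L 0) (Torus.proj L x) else 0))
              (fun δ _ => hterm δ x hxbox y) (mem_univ δ₁)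
    -- sum the termwise bounds and enlarge the index sets
    have hB : ∑ x ∈ S, ((((zdGraph d).neighborFinset x).filter fun y => y ∉ S).card : ℝ) *
        isingTwoPoint (zdGraph d) S β 0 .free 0 x ≤ ∑ x ∈ box d n, ∑ y ∈ box d n, ∑ δ : Fin d × Bool,
        (if (zdGraph d).Adj x y ∧ ¬ c δ 0 ∧ ¬ c δ x ∧ c δ y then
          isingTwoPoint (torusGraph d L) (W δ) β 0 .free (Torus.proj L 0) (Torus.proj L x) else 0) := by
      calc ∑ x ∈ S, ((((zdGraph d).neighborFinset x).filter fun y => y ∉ S).card : ℝ) *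
            isingTwoPoint (zdGraph d) S β 0 .free 0 x
          = ∑ x ∈ S, ∑ _y ∈ ((zdGraph d).neighborFinset x).filter (fun y => y ∉ S),
              isingTwoPoint (zdGraph d) S β 0 .free 0 x := by
            refine Finset.sum_congr rfl fun x _ => ?_
            rw [Finset.sum_const, nsmul_eq_mul]
        _ ≤ ∑ x ∈ S, ∑ y ∈ ((zdGraph d).neighborFinset x).filter (fun y => y ∉ S),
              ∑ δ : Fin d × Bool,
                (if (zdGraph d).Adj x y ∧ ¬ c δ 0 ∧ ¬ c δ x ∧ c δ y then
                  isingTwoPoint (torusGraph d L) (W δ) β 0 .free (Torus.proj L 0) (Torus.proj L x) else 0) :=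
            sum_le_sum fun x hx => sum_le_sum fun y hy => hA x hx y hy
        _ ≤ ∑ x ∈ S, ∑ y ∈ box d n, ∑ δ : Fin d × Bool,
                (if (zdGraph d).Adj x y ∧ ¬ c δ 0 ∧ ¬ c δ x ∧ c δ y then
                  isingTwoPoint (torusGraph d L) (W δ) β 0 .free (Torus.proj L 0) (Torus.proj L x) else 0) := by
            refine sum_le_sum fun x hx => sum_le_sum_of_subset_of_nonneg ?_ ?_
            · intro y hy
              obtain ⟨hyadj, -⟩ := mem_filter.1 hy
              rw [SimpleGraph.mem_neighborFinset] at hyadj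
              exact mem_box_of_adj_of_mem_box_pred hn (hSpred hx) hyadj
            · intro y _ _
              exact sum_nonneg fun δ _ => hterm δ x (hSbox hx) y
        _ ≤ ∑ x ∈ box d n, ∑ y ∈ box d n, ∑ δ : Fin d × Bool,
                (if (zdGraph d).Adj x y ∧ ¬ c δ 0 ∧ ¬ c δ x ∧ c δ y then
                  isingTwoPoint (torusGraph d L) (W δ) β 0 .free (Torus.proj L 0) (Torus.proj L x) else 0) := by
            refine sum_le_sum_of_subset_of_nonneg hSbox fun x hx _ => ?_
            exact sum_nonneg fun y _ => sum_nonneg fun δ _ => hterm δ x hx y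
    -- reorder the sums
    have hre : ∑ x ∈ box d n, ∑ y ∈ box d n, ∑ δ : Fin d × Bool,
        (if (zdGraph d).Adj x y ∧ ¬ c δ 0 ∧ ¬ c δ x ∧ c δ y then
          isingTwoPoint (torusGraph d L) (W δ) β 0 .free (Torus.proj L 0) (Torus.proj L x) else 0) =
        ∑ δ : Fin d × Bool, ∑ x ∈ box d n, ∑ y ∈ box d n,
          (if (zdGraph d).Adj x y ∧ ¬ c δ 0 ∧ ¬ c δ x ∧ c δ y then
            isingTwoPoint (torusGraph d L) (W δ) β 0 .free (Torus.proj L 0) (Torus.proj L x) else 0) := by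
      calc ∑ x ∈ box d n, ∑ y ∈ box d n, ∑ δ : Fin d × Bool,
            (if (zdGraph d).Adj x y ∧ ¬ c δ 0 ∧ ¬ c δ x ∧ c δ y then
              isingTwoPoint (torusGraph d L) (W δ) β 0 .free (Torus.proj L 0) (Torus.proj L x) else 0)
          = ∑ x ∈ box d n, ∑ δ : Fin d × Bool, ∑ y ∈ box d n,
            (if (zdGraph d).Adj x y ∧ ¬ c δ 0 ∧ ¬ c δ x ∧ c δ y then
              isingTwoPoint (torusGraph d L) (W δ) β 0 .free (Torus.proj L 0) (Torus.proj L x) else 0) :=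
            Finset.sum_congr rfl fun x _ => Finset.sum_comm
        _ = ∑ δ : Fin d × Bool, ∑ x ∈ box d n, ∑ y ∈ box d n,
            (if (zdGraph d).Adj x y ∧ ¬ c δ 0 ∧ ¬ c δ x ∧ c δ y then
              isingTwoPoint (torusGraph d L) (W δ) β 0 .free (Torus.proj L 0) (Torus.proj L x) else 0) :=
            Finset.sum_comm
    rw [hre] at hB
    have h1 := hφS.trans (mul_le_mul_of_nonneg_left hB hw)
    linarith

section Integrate

open scoped ENNReal symmDiff

variable {L : ℕ} [NeZero L]

/-! ### Integration over the sourceless current of the even torus -/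

open Classical in
/-- **The torus inequality from Lemma 2.5, general weight** (near-critical twin of the tree's
`DCPLower.torusIneq_of_lemma25`). On the even torus `(ℤ/Lℤ)^d` (`L ≥ 4n + 2`), at `β ≥ 0`, write
`Z(A)` for the current sums of the whole torus, `θ_δ` / `H_δ` for the `2d` direction fold data
(`dirTheta`, `dirHalf`), `c_δ(𝐧, z) = [z̄ ↔_{ℳ_δ(𝐧)} ℍ_δ]` and `W_δ(𝐧) = {z̄ : z ∈ Λ_n, ¬c_δ(𝐧,z)}`.
If the boundary input `1 ≤ w Σ_{x ∈ S} #{y ∉ S : y ∼ x} ⟨σ₀σ_x⟩_S` holds for the finite `S ∋ 0`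
inside `Λ_{n-1}` (near-critical: `φ_β(S) ≥ 1/2`, `w = 2β`, eq. (2.5)) and **Lemma 2.5** of
Duminil-Copin–Panis 2025 holds in the per-pair current form
`Σ_{∂𝐧 = ∅} w(𝐧) 𝟙[0̄, x̄ ∈ W_δ(𝐧), c_δ(𝐧,y)] ⟨σ_{0̄}σ_{x̄}⟩_{W_δ(𝐧)} ≤ (Z(0̄x̄) - Z(0̄ θ_δx̄)) ⟨σ_ȳσ_{θ_δȳ}⟩_{𝕋_L}`
(with `Z(0̄ θ_δx̄) ≤ Z(0̄x̄)`), then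
`1 ≤ Σ_δ ( ⟨σ_{0̄}σ_{θ_δ0̄}⟩_{𝕋_L} + w Σ_{x,y ∈ Λ_n, y∼x} (⟨σ_{0̄}σ_{x̄}⟩ - ⟨σ_{0̄}σ_{θ_δ x̄}⟩) ⟨σ_ȳσ_{θ_δȳ}⟩ )`:
integrate `pointwise_master_weight` against `𝐏^∅_{𝕋_L}` ("`½ 𝐏^∅_β[0 ∈ 𝒮_n] ≤ 𝐄^∅_β[𝟙_{0∈𝒮_n} φ_β(𝒮_n)]`",
eq. (2.5)), use Lemma 2.4 in current form (`IsFoldable.tsum_empty_connFix_le`, eq. (2.12)) for the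
first terms and Lemma 2.5 for the others, and divide by `Z(∅)`. The proof is the tree's, with
`tanh β` replaced by `w`. [cite: DuminilCopinPanis2025LowerBounds, §2.2, eqs. (2.5)–(2.8) and (2.20)–(2.24)] -/
theorem torusIneq_of_lemma25_weight (hL : Even L) {n : ℕ} (hn : 1 ≤ n) (hnL : 4 * n + 2 ≤ L) {β : ℝ} (hβ : 0 ≤ β)
    {w : ℝ} (hw : 0 ≤ w)
    (hφ : ∀ S : Finset (Site d), (0 : Site d) ∈ S → S ⊆ box d (n - 1) →
      1 ≤ w * ∑ x ∈ S, ((((zdGraph d).neighborFinset x).filter fun y => y ∉ S).card : ℝ) *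
        isingTwoPoint (zdGraph d) S β 0 .free 0 x)
    (H25 : ∀ δ : Fin d × Bool, ∀ x ∈ box d n, ∀ y ∈ box d n, (zdGraph d).Adj x y →
      ∑' nc : edgesIn (torusGraph d L) univ → ℕ,
        ind (csources (torusGraph d L) univ nc = ∅ ∧ CSupp (torusGraph d L) univ (edgesIn (torusGraph d L) univ) nc) *
          cweight (torusGraph d L) univ β nc *
          (ind (¬ (isFoldable_dir hL (by omega) n δ).ConnFix ((isFoldable_dir hL (by omega) n δ).fold nc) (Torus.proj L 0) ∧
                ¬ (isFoldable_dir hL (by omega) n δ).ConnFix ((isFoldable_dir hL (by omega) n δ).fold nc) (Torus.proj L x) ∧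
                (isFoldable_dir hL (by omega) n δ).ConnFix ((isFoldable_dir hL (by omega) n δ).fold nc) (Torus.proj L y)) *
            ENNReal.ofReal (isingTwoPoint (torusGraph d L)
              (((box d n).filter fun z => ¬ (isFoldable_dir hL (by omega) n δ).ConnFix
                  ((isFoldable_dir hL (by omega) n δ).fold nc) (Torus.proj L z)).image (Torus.proj L))
              β 0 .free (Torus.proj L 0) (Torus.proj L x))) ≤
        (currentZ (torusGraph d L) univ β (edgesIn (torusGraph d L) univ) ({Torus.proj L 0} ∆ {Torus.proj L x}) -
            currentZ (torusGraph d L) univ β (edgesIn (torusGraph d L) univ)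
              ({Torus.proj L 0} ∆ {dirTheta L n δ (Torus.proj L x)})) *
          ENNReal.ofReal (isingTwoPoint (torusGraph d L) univ β 0 .free (Torus.proj L y) (dirTheta L n δ (Torus.proj L y))))
    (Hle : ∀ δ : Fin d × Bool, ∀ x ∈ box d n,
      currentZ (torusGraph d L) univ β (edgesIn (torusGraph d L) univ) ({Torus.proj L 0} ∆ {dirTheta L n δ (Torus.proj L x)}) ≤
        currentZ (torusGraph d L) univ β (edgesIn (torusGraph d L) univ) ({Torus.proj L 0} ∆ {Torus.proj L x})) :
    (1 : ℝ) ≤ ∑ δ : Fin d × Bool,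
      (isingTwoPoint (torusGraph d L) univ β 0 .free (Torus.proj L 0) (Torus.proj L (dirRefl δ n 0)) +
        w * ∑ x ∈ box d n, ∑ y ∈ box d n,
          if (zdGraph d).Adj x y then
            (isingTwoPoint (torusGraph d L) univ β 0 .free (Torus.proj L 0) (Torus.proj L x) -
                isingTwoPoint (torusGraph d L) univ β 0 .free (Torus.proj L 0) (Torus.proj L (dirRefl δ n x))) *
              isingTwoPoint (torusGraph d L) univ β 0 .free (Torus.proj L y) (Torus.proj L (dirRefl δ n y))
          else 0) := by
  classical
  -- notation
  set GT := torusGraph d L with hGT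
  set E := edgesIn GT univ with hE
  have h2L : 2 < L := by omega
  set hD : ∀ δ : Fin d × Bool, IsFoldable GT (dirTheta L n δ) univ (dirHalf L n δ) :=
    fun δ => isFoldable_dir hL h2L n δ with hhD
  -- the connection predicates of a current and the random volumes
  set cT : (E → ℕ) → Fin d × Bool → Site d → Prop :=
    fun nc δ z => (hD δ).ConnFix ((hD δ).fold nc) (Torus.proj L z) with hcT
  set Z : Finset (TorusSite d L) → ℝ≥0∞ := fun A => currentZ GT univ β E A with hZ
  set wt : (E → ℕ) → ℝ≥0∞ := fun nc => ind (csources GT univ nc = ∅ ∧ CSupp GT univ E nc) * cweight GT univ β nc with hwt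
  set p0 := Torus.proj L (0 : Site d) with hp0
  -- face points are connected
  have hface : ∀ nc : E → ℕ, ∀ z ∈ box d n, ∀ i : Fin d,
      (z i = n → cT nc (i, true) z) ∧ (z i = -(n : ℤ) → cT nc (i, false) z) := by
    intro nc z hz i
    constructor
    · intro hzi
      refine ⟨Torus.proj L z, mem_univ _, dirTheta_proj_eq_self hL hnL hz (i, true) (by simpa [sgn] using hzi), ?_⟩
      exact Relation.ReflTransGen.refl
    · intro hzi
      refine ⟨Torus.proj L z, mem_univ _, dirTheta_proj_eq_self hL hnL hz (i, false) (by simpa [sgn] using hzi), ?_⟩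
      exact Relation.ReflTransGen.refl
  -- the pointwise inequality for every current
  set A : (E → ℕ) → ℝ := fun nc => ∑ δ : Fin d × Bool, if cT nc δ 0 then (1 : ℝ) else 0 with hA
  set B : (E → ℕ) → ℝ := fun nc => ∑ δ : Fin d × Bool, ∑ x ∈ box d n, ∑ y ∈ box d n,
    (if (zdGraph d).Adj x y ∧ ¬ cT nc δ 0 ∧ ¬ cT nc δ x ∧ cT nc δ y then
      isingTwoPoint GT (((box d n).filter fun z => ¬ cT nc δ z).image (Torus.proj L)) β 0 .free p0 (Torus.proj L x)
    else 0) with hB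
  have hpt : ∀ nc, (1 : ℝ) ≤ A nc + w * B nc := fun nc =>
    pointwise_master_weight (L := L) hn (by omega) hβ hw hφ (cT nc) (hface nc)
  have hA0 : ∀ nc, 0 ≤ A nc := fun nc => sum_nonneg fun δ _ => by split_ifs <;> norm_num
  have hB0 : ∀ nc, 0 ≤ B nc := fun nc =>
    sum_nonneg fun δ _ => sum_nonneg fun x hx => sum_nonneg fun y _ => ite_twoPoint_nonneg hβ (cT nc) δ hx y
  -- Step 1: integrate the pointwise inequality against the sourceless current
  have hZdef : Z ∅ = ∑' nc, wt nc := rfl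
  have step1 : Z ∅ ≤ ∑' nc, (wt nc * ENNReal.ofReal (A nc) + ENNReal.ofReal (w) * (wt nc * ENNReal.ofReal (B nc))) := by
    rw [hZdef]
    refine ENNReal.tsum_le_tsum fun nc => ?_
    have h1 : (1 : ℝ≥0∞) ≤ ENNReal.ofReal (A nc + w * B nc) := ENNReal.one_le_ofReal.2 (hpt nc)
    calc wt nc = wt nc * 1 := (mul_one _).symm
      _ ≤ wt nc * ENNReal.ofReal (A nc + w * B nc) := mul_le_mul_right h1 _
      _ = wt nc * ENNReal.ofReal (A nc) + ENNReal.ofReal (w) * (wt nc * ENNReal.ofReal (B nc)) := by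
          rw [ENNReal.ofReal_add (hA0 nc) (mul_nonneg hw (hB0 nc)), ENNReal.ofReal_mul hw]
          ring
  rw [ENNReal.tsum_add, ENNReal.tsum_mul_left] at step1
  -- Step 2: the first term and Lemma 2.4
  have hp0H : ∀ δ, p0 ∈ dirHalf L n δ := fun δ => proj_zero_mem_dirHalf hL hn hnL δ
  have step2 : ∑' nc, wt nc * ENNReal.ofReal (A nc) ≤ ∑ δ : Fin d × Bool, Z ({p0} ∆ {dirTheta L n δ p0}) := by
    have hre : ∀ nc, wt nc * ENNReal.ofReal (A nc) = ∑ δ : Fin d × Bool, wt nc * ind (cT nc δ 0) := by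
      intro nc
      rw [hA]
      simp only
      rw [ofReal_sum_ite_one, Finset.mul_sum]
    simp_rw [hre]
    rw [Summable.tsum_finsetSum (fun _ _ => ENNReal.summable)]
    refine Finset.sum_le_sum fun δ _ => ?_
    exact (hD δ).tsum_empty_connFix_le (hp0H δ) hβ
  -- Step 3: the triple sum and Lemma 2.5
  set R : Fin d × Bool → Site d → Site d → ℝ≥0∞ := fun δ x y =>
    if (zdGraph d).Adj x y then
      (Z ({p0} ∆ {Torus.proj L x}) - Z ({p0} ∆ {dirTheta L n δ (Torus.proj L x)})) *
        ENNReal.ofReal (isingTwoPoint GT univ β 0 .free (Torus.proj L y) (dirTheta L n δ (Torus.proj L y)))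
    else 0 with hR
  have step3 : ∑' nc, wt nc * ENNReal.ofReal (B nc) ≤
      ∑ δ : Fin d × Bool, ∑ x ∈ box d n, ∑ y ∈ box d n, R δ x y := by
    have hre : ∀ nc, wt nc * ENNReal.ofReal (B nc) = ∑ δ : Fin d × Bool, ∑ x ∈ box d n, ∑ y ∈ box d n,
        wt nc * (ind ((zdGraph d).Adj x y ∧ ¬ cT nc δ 0 ∧ ¬ cT nc δ x ∧ cT nc δ y) *
          ENNReal.ofReal (isingTwoPoint GT (((box d n).filter fun z => ¬ cT nc δ z).image (Torus.proj L)) β 0 .free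
            p0 (Torus.proj L x))) := by
      intro nc
      rw [hB]
      simp only
      rw [ENNReal.ofReal_sum_of_nonneg (fun δ _ => sum_nonneg fun x hx => sum_nonneg fun y _ =>
        ite_twoPoint_nonneg hβ (cT nc) δ hx y), Finset.mul_sum]
      refine Finset.sum_congr rfl fun δ _ => ?_
      rw [ENNReal.ofReal_sum_of_nonneg (fun x hx => sum_nonneg fun y _ => ite_twoPoint_nonneg hβ (cT nc) δ hx y),
        Finset.mul_sum]
      refine Finset.sum_congr rfl fun x hx => ?_
      rw [ENNReal.ofReal_sum_of_nonneg (fun y _ => ite_twoPoint_nonneg hβ (cT nc) δ hx y), Finset.mul_sum]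
      refine Finset.sum_congr rfl fun y _ => ?_
      rw [ofReal_ite_eq_ind_mul]
    simp_rw [hre]
    rw [Summable.tsum_finsetSum (fun _ _ => ENNReal.summable)]
    refine Finset.sum_le_sum fun δ _ => ?_
    rw [Summable.tsum_finsetSum (fun _ _ => ENNReal.summable)]
    refine Finset.sum_le_sum fun x hx => ?_
    rw [Summable.tsum_finsetSum (fun _ _ => ENNReal.summable)]
    refine Finset.sum_le_sum fun y hy => ?_
    by_cases hxy : (zdGraph d).Adj x y
    · rw [hR]
      simp only [if_pos hxy]
      have h25 := H25 δ x hx y hy hxy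
      refine le_trans (le_of_eq (tsum_congr fun nc => ?_)) h25
      rw [ind_congr (show ((zdGraph d).Adj x y ∧ ¬ cT nc δ 0 ∧ ¬ cT nc δ x ∧ cT nc δ y) ↔
        (¬ cT nc δ 0 ∧ ¬ cT nc δ x ∧ cT nc δ y) from ⟨fun h => h.2, fun h => ⟨hxy, h⟩⟩)]
    · rw [hR]
      simp only [if_neg hxy]
      refine le_of_eq (ENNReal.tsum_eq_zero.2 fun nc => ?_)
      rw [ind_of_false (fun h => hxy h.1), zero_mul, mul_zero]
  -- Step 4: the inequality in `ℝ≥0∞`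
  have step4 : Z ∅ ≤ ∑ δ : Fin d × Bool, Z ({p0} ∆ {dirTheta L n δ p0}) +
      ENNReal.ofReal (w) * ∑ δ : Fin d × Bool, ∑ x ∈ box d n, ∑ y ∈ box d n, R δ x y :=
    step1.trans (add_le_add step2 (mul_le_mul_right step3 _))
  -- Step 5: to real numbers
  have hfin : ∀ A', Z A' ≠ ∞ := fun A' => currentZ_univ_ne_top GT hβ A'
  have hZ1 : 1 ≤ Z ∅ := one_le_currentZ_univ_empty GT β
  set z0 : ℝ := (Z ∅).toReal with hz0def
  have hz0 : 0 < z0 := ENNReal.toReal_pos (ne_of_gt (lt_of_lt_of_le zero_lt_one hZ1)) (hfin ∅)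
  have hdict : ∀ a b, isingTwoPoint GT univ β 0 .free a b = (Z ({a} ∆ {b})).toReal / z0 := fun a b =>
    isingTwoPoint_univ_eq_currentZ_div GT hβ a b
  have hdict' : ∀ a b, (Z ({a} ∆ {b})).toReal = z0 * isingTwoPoint GT univ β 0 .free a b := fun a b => by
    rw [hdict, mul_div_cancel₀ _ hz0.ne']
  have hRfin : ∀ δ x y, R δ x y ≠ ∞ := by
    intro δ x y
    rw [hR]
    simp only
    split_ifs
    · exact ENNReal.mul_ne_top (ENNReal.sub_ne_top (hfin _)) ENNReal.ofReal_ne_top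
    · exact ENNReal.zero_ne_top
  have hRreal : ∀ δ, ∀ x ∈ box d n, ∀ y, (R δ x y).toReal =
      if (zdGraph d).Adj x y then
        ((Z ({p0} ∆ {Torus.proj L x})).toReal - (Z ({p0} ∆ {dirTheta L n δ (Torus.proj L x)})).toReal) *
          isingTwoPoint GT univ β 0 .free (Torus.proj L y) (dirTheta L n δ (Torus.proj L y))
      else 0 := by
    intro δ x hx y
    rw [hR]
    simp only
    split_ifs with hxy
    · rw [ENNReal.toReal_mul, ENNReal.toReal_sub_of_le (Hle δ x hx) (hfin _),
        ENNReal.toReal_ofReal (isingTwoPoint_free_nonneg_of_mem _ hβ (mem_univ _) (mem_univ _))]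
    · rfl
  have hsumfin : ∀ δ : Fin d × Bool, ∑ x ∈ box d n, ∑ y ∈ box d n, R δ x y ≠ ∞ := fun δ =>
    ENNReal.sum_ne_top.2 fun x _ => ENNReal.sum_ne_top.2 fun y _ => hRfin δ x y
  have hRHSfin : ∑ δ : Fin d × Bool, Z ({p0} ∆ {dirTheta L n δ p0}) +
      ENNReal.ofReal (w) * ∑ δ : Fin d × Bool, ∑ x ∈ box d n, ∑ y ∈ box d n, R δ x y ≠ ∞ :=
    ENNReal.add_ne_top.2 ⟨ENNReal.sum_ne_top.2 fun δ _ => hfin _,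
      ENNReal.mul_ne_top ENNReal.ofReal_ne_top (ENNReal.sum_ne_top.2 fun δ _ => hsumfin δ)⟩
  have step5 : z0 ≤ ∑ δ : Fin d × Bool, (Z ({p0} ∆ {dirTheta L n δ p0})).toReal +
      w * ∑ δ : Fin d × Bool, ∑ x ∈ box d n, ∑ y ∈ box d n, (R δ x y).toReal := by
    have h := ENNReal.toReal_mono hRHSfin step4
    rw [ENNReal.toReal_add (ENNReal.sum_ne_top.2 fun δ _ => hfin _)
        (ENNReal.mul_ne_top ENNReal.ofReal_ne_top (ENNReal.sum_ne_top.2 fun δ _ => hsumfin δ)),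
      ENNReal.toReal_sum (fun δ _ => hfin _), ENNReal.toReal_mul, ENNReal.toReal_ofReal hw,
      ENNReal.toReal_sum (fun δ _ => hsumfin δ)] at h
    refine h.trans (le_of_eq ?_)
    congr 1
    congr 1
    refine Finset.sum_congr rfl fun δ _ => ?_
    rw [ENNReal.toReal_sum (fun x _ => ENNReal.sum_ne_top.2 fun y _ => hRfin δ x y)]
    refine Finset.sum_congr rfl fun x _ => ?_
    exact ENNReal.toReal_sum (fun y _ => hRfin δ x y)
  -- Step 6: divide by `Z(∅)` and identify the two-point functions
  have hθ0 : ∀ δ : Fin d × Bool, dirTheta L n δ p0 = Torus.proj L (dirRefl δ n 0) := fun δ => dirTheta_proj n δ 0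
  have h1 : ∀ δ : Fin d × Bool, (Z ({p0} ∆ {dirTheta L n δ p0})).toReal =
      z0 * isingTwoPoint GT univ β 0 .free p0 (Torus.proj L (dirRefl δ n 0)) := fun δ => by
    rw [hθ0 δ, hdict']
  have h2 : ∀ δ : Fin d × Bool, ∑ x ∈ box d n, ∑ y ∈ box d n, (R δ x y).toReal =
      z0 * ∑ x ∈ box d n, ∑ y ∈ box d n,
        (if (zdGraph d).Adj x y then
          (isingTwoPoint GT univ β 0 .free p0 (Torus.proj L x) -
              isingTwoPoint GT univ β 0 .free p0 (Torus.proj L (dirRefl δ n x))) *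
            isingTwoPoint GT univ β 0 .free (Torus.proj L y) (Torus.proj L (dirRefl δ n y))
        else 0) := by
    intro δ
    rw [Finset.mul_sum]
    refine Finset.sum_congr rfl fun x hx => ?_
    rw [Finset.mul_sum]
    refine Finset.sum_congr rfl fun y _ => ?_
    rw [hRreal δ x hx y]
    split_ifs with hxy
    · rw [hdict' p0 (Torus.proj L x), dirTheta_proj n δ x, hdict', dirTheta_proj n δ y]
      ring
    · rw [mul_zero]
  simp only [h1, h2] at step5
  rw [← Finset.mul_sum, ← Finset.mul_sum, ← mul_assoc, mul_comm (w) z0, mul_assoc, ← mul_add] at step5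
  have hfinal : (1 : ℝ) ≤ ∑ δ : Fin d × Bool, isingTwoPoint GT univ β 0 .free p0 (Torus.proj L (dirRefl δ n 0)) +
      w * ∑ δ : Fin d × Bool, ∑ x ∈ box d n, ∑ y ∈ box d n,
        (if (zdGraph d).Adj x y then
          (isingTwoPoint GT univ β 0 .free p0 (Torus.proj L x) -
              isingTwoPoint GT univ β 0 .free p0 (Torus.proj L (dirRefl δ n x))) *
            isingTwoPoint GT univ β 0 .free (Torus.proj L y) (Torus.proj L (dirRefl δ n y))
        else 0) := by
    nth_rewrite 1 [← mul_one z0] at step5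
    exact le_of_mul_le_mul_left step5 hz0
  rw [Finset.mul_sum, ← Finset.sum_add_distrib] at hfinal
  exact hfinal

/-! ### The hypothesis `Hle` and the sharp-length input -/

/-- **`Z(0̄, θ_δx̄) ≤ Z(0̄, x̄)` for box points** (the hypothesis `Hle` of the torus inequality): a
point `x ∈ Λ_n` either lies in the half `H_δ` of the direction `δ` — then this is the step
`Z^{{0,𝓡x}} = Z^{{0,x}}[x ↔_ℳ ℍ] ≤ Z^{{0,x}}` of the proof of Lemma 2.5
(`IsFoldable.currentZ_pair_theta_le`) — or on its hyperplane, where `θ_δ x̄ = x̄`. [cite: DuminilCopinPanis2025LowerBounds, Lemma 2.5 (proof, eq. (2.22))] -/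
theorem hle_torus (hL : Even L) {n : ℕ} (hn : 1 ≤ n) (hnL : 4 * n + 2 ≤ L) {β : ℝ} (hβ : 0 ≤ β)
    (δ : Fin d × Bool) {x : Site d} (hx : x ∈ box d n) :
    currentZ (torusGraph d L) univ β (edgesIn (torusGraph d L) univ)
        ({Torus.proj L 0} ∆ {dirTheta L n δ (Torus.proj L x)}) ≤
      currentZ (torusGraph d L) univ β (edgesIn (torusGraph d L) univ) ({Torus.proj L 0} ∆ {Torus.proj L x}) := by
  rcases proj_mem_dirHalf_or_fixed hL hnL hx δ with hmem | hfix
  · exact (isFoldable_dir hL (by omega) n δ).currentZ_pair_theta_le (proj_zero_mem_dirHalf hL hn hnL δ) hmem hβ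
  · rw [hfix]

end Integrate

/-- **The sharp-length input of eq. (2.5), weight form**: for `2 ≤ n ≤ L(β)` every `S ∋ 0`
inside `Λ_{n-1}` has `φ_β(S) ≥ 1/2` (`half_le_dcpPhi_of_subset_box_pred`), i.e.
`1 ≤ 2β Σ_{x ∈ S} #{y ∉ S : y ∼ x} ⟨σ₀σ_x⟩_{S,β}`. [cite: DuminilCopinPanis2025LowerBounds, §2.2, eq. (2.5)] -/
theorem sharpLength_input {β : ℝ} {n : ℕ} (hn : 2 ≤ n) (hnL : (n : ℕ∞) ≤ sharpLength d β) :
    ∀ S : Finset (Site d), (0 : Site d) ∈ S → S ⊆ box d (n - 1) →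
      1 ≤ 2 * β * ∑ x ∈ S, ((((zdGraph d).neighborFinset x).filter fun y => y ∉ S).card : ℝ) *
        isingTwoPoint (zdGraph d) S β 0 .free 0 x := by
  intro S h0 hS
  have h := half_le_dcpPhi_of_subset_box_pred hn hnL h0 hS
  unfold dcpPhi at h
  rw [mul_assoc]
  linarith

/-! ### The limit `L → ∞` along even tori (`m*(β) = 0`) -/

/-- **Torus two-point functions converge along the even tori** `(ℤ/(2k+2)ℤ)^d` to the
infinite-volume free two-point function, when `m*(β) = 0`:
`⟨σ_{ā}σ_{b̄}⟩_{𝕋_{2k+2};β} → ⟨σ_aσ_b⟩⁺_β = ⟨σ_aσ_b⟩^∅_β = ⟨σ₀σ_{b-a}⟩^∅_β`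
(`abs_isingTorusTwoPoint_sub_plusCorr_le_of_spontaneousMagnetization_eq_zero`, Lebowitz–
Martin-Löf `⟨·⟩^∅ = ⟨·⟩⁺` at `m* = 0`, translation invariance; the diagonal `a = b` is the constant `1`).
[cite: AizenmanDuminilCopinAnnals2021, arXiv:1912.07973 Prop. 5.2 (p. 17)] -/
theorem tendsto_isingTorusTwoPoint_even {β : ℝ} (hβ : 0 ≤ β) (hm : spontaneousMagnetization d β = 0)
    (a b : Site d) :
    Tendsto (fun k : ℕ => isingTorusTwoPoint d (2 * k + 1 + 1) β 0
        (Torus.proj (2 * k + 1 + 1) a) (Torus.proj (2 * k + 1 + 1) b))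
      atTop (𝓝 (twoPointFree d β (b - a))) := by
  rw [Metric.tendsto_atTop]
  intro ε hε
  rcases eq_or_ne a b with rfl | hab
  · refine ⟨0, fun k _ => ?_⟩
    rw [sub_self, twoPointFree_zero']
    simp only [isingTorusTwoPoint, isingTwoPoint_self, dist_self]
    exact hε
  · obtain ⟨N₀, hN₀⟩ :=
      abs_isingTorusTwoPoint_sub_plusCorr_le_of_spontaneousMagnetization_eq_zero hβ hm hab (half_pos hε)
    refine ⟨N₀, fun k hk => ?_⟩
    have h := hN₀ (2 * k + 1 + 1) (by omega)
    have hpc : plusCorr d β 0 {a, b} = twoPointFree d β (b - a) := by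
      rw [← freeCorr_eq_plusCorr_of_spontaneousMagnetization_eq_zero hβ hm, ← freePair_eq_twoPointFree_sub hβ a b]
      simp only [freePair, freeCorr, spinPair_eq_spinProduct hab]
    rw [Real.dist_eq, ← hpc]
    linarith

open Classical in
open scoped ENNReal symmDiff in
/-- **The infinite-volume inequality** ("We conclude by taking `Λ ↗ ℤ^d`", end of the proof of
Lemma 2.5, here along the even tori): for `β ≥ 0` with `m*(β) = 0`, `n ≥ 1`, a weight `w ≥ 0`
satisfying the boundary input inside `Λ_{n-1}`, and Lemma 2.5 in per-pair current form on every
even torus of side `L ≥ 4n + 2`,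
`1 ≤ Σ_δ ( ⟨σ₀σ_{𝓡_δ(0)}⟩_β + w Σ_{x,y ∈ Λ_n, y ∼ x} (⟨σ₀σ_x⟩_β - ⟨σ₀σ_{𝓡_δ(x)}⟩_β) ⟨σ₀σ_{𝓡_δ(y) - y}⟩_β )`
over the `2d` directions `δ`, for the free infinite-volume two-point function. [cite: DuminilCopinPanis2025LowerBounds, §2.2, eqs. (2.5)–(2.8) with Lemmas 2.4–2.5] -/
theorem infiniteVolume_ineq_of_lemma25 {β : ℝ} (hβ : 0 ≤ β) (hm : spontaneousMagnetization d β = 0)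
    {n : ℕ} (hn : 1 ≤ n) {w : ℝ} (hw : 0 ≤ w)
    (hφ : ∀ S : Finset (Site d), (0 : Site d) ∈ S → S ⊆ box d (n - 1) →
      1 ≤ w * ∑ x ∈ S, ((((zdGraph d).neighborFinset x).filter fun y => y ∉ S).card : ℝ) *
        isingTwoPoint (zdGraph d) S β 0 .free 0 x)
    (H25 : ∀ (L : ℕ) [NeZero L] (hL : Even L) (hnL : 4 * n + 2 ≤ L),
      ∀ δ : Fin d × Bool, ∀ x ∈ box d n, ∀ y ∈ box d n, (zdGraph d).Adj x y →
      ∑' nc : edgesIn (torusGraph d L) univ → ℕ,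
        ind (csources (torusGraph d L) univ nc = ∅ ∧ CSupp (torusGraph d L) univ (edgesIn (torusGraph d L) univ) nc) *
          cweight (torusGraph d L) univ β nc *
          (ind (¬ (isFoldable_dir hL (by omega) n δ).ConnFix ((isFoldable_dir hL (by omega) n δ).fold nc) (Torus.proj L 0) ∧
                ¬ (isFoldable_dir hL (by omega) n δ).ConnFix ((isFoldable_dir hL (by omega) n δ).fold nc) (Torus.proj L x) ∧
                (isFoldable_dir hL (by omega) n δ).ConnFix ((isFoldable_dir hL (by omega) n δ).fold nc) (Torus.proj L y)) *
            ENNReal.ofReal (isingTwoPoint (torusGraph d L)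
              (((box d n).filter fun z => ¬ (isFoldable_dir hL (by omega) n δ).ConnFix
                  ((isFoldable_dir hL (by omega) n δ).fold nc) (Torus.proj L z)).image (Torus.proj L))
              β 0 .free (Torus.proj L 0) (Torus.proj L x))) ≤
        (currentZ (torusGraph d L) univ β (edgesIn (torusGraph d L) univ) ({Torus.proj L 0} ∆ {Torus.proj L x}) -
            currentZ (torusGraph d L) univ β (edgesIn (torusGraph d L) univ)
              ({Torus.proj L 0} ∆ {dirTheta L n δ (Torus.proj L x)})) *
          ENNReal.ofReal (isingTwoPoint (torusGraph d L) univ β 0 .free (Torus.proj L y) (dirTheta L n δ (Torus.proj L y)))) :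
    (1 : ℝ) ≤ ∑ δ : Fin d × Bool, (twoPointFree d β (dirRefl δ n 0) +
      w * ∑ x ∈ box d n, ∑ y ∈ box d n,
        if (zdGraph d).Adj x y then
          (twoPointFree d β x - twoPointFree d β (dirRefl δ n x)) * twoPointFree d β (dirRefl δ n y - y)
        else 0) := by
  -- the even tori `L_k = 2k + 2`, `k ≥ 2n`
  set T : ℕ → Site d → Site d → ℝ := fun k a b =>
    isingTorusTwoPoint d (2 * k + 1 + 1) β 0 (Torus.proj (2 * k + 1 + 1) a) (Torus.proj (2 * k + 1 + 1) b) with hT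
  have hlim : ∀ a b, Tendsto (fun k => T k a b) atTop (𝓝 (twoPointFree d β (b - a))) := fun a b =>
    tendsto_isingTorusTwoPoint_even hβ hm a b
  have hT0 : ∀ b, Tendsto (fun k => T k 0 b) atTop (𝓝 (twoPointFree d β b)) := fun b => by
    simpa using hlim 0 b
  -- the torus inequality for `k ≥ 2n`
  have hk : ∀ k, 2 * n ≤ k → (1 : ℝ) ≤ ∑ δ : Fin d × Bool, (T k 0 (dirRefl δ n 0) +
      w * ∑ x ∈ box d n, ∑ y ∈ box d n,
        if (zdGraph d).Adj x y then (T k 0 x - T k 0 (dirRefl δ n x)) * T k y (dirRefl δ n y) else 0) := by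
    intro k hk
    have hL : Even (2 * k + 1 + 1) := ⟨k + 1, by ring⟩
    have hnL : 4 * n + 2 ≤ 2 * k + 1 + 1 := by omega
    exact torusIneq_of_lemma25_weight hL hn hnL hβ hw hφ (H25 _ hL hnL)
      (fun δ x hx => hle_torus hL hn hnL hβ δ hx)
  -- termwise limits
  have hterm : ∀ δ x y, Tendsto (fun k => if (zdGraph d).Adj x y then
      (T k 0 x - T k 0 (dirRefl δ n x)) * T k y (dirRefl δ n y) else 0) atTop
      (𝓝 (if (zdGraph d).Adj x y then
        (twoPointFree d β x - twoPointFree d β (dirRefl δ n x)) * twoPointFree d β (dirRefl δ n y - y) else 0)) := by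
    intro δ x y
    split_ifs
    · exact ((hT0 x).sub (hT0 _)).mul (hlim y _)
    · exact tendsto_const_nhds
  have hsum : Tendsto (fun k => ∑ δ : Fin d × Bool, (T k 0 (dirRefl δ n 0) +
      w * ∑ x ∈ box d n, ∑ y ∈ box d n,
        if (zdGraph d).Adj x y then (T k 0 x - T k 0 (dirRefl δ n x)) * T k y (dirRefl δ n y) else 0)) atTop
      (𝓝 (∑ δ : Fin d × Bool, (twoPointFree d β (dirRefl δ n 0) +
        w * ∑ x ∈ box d n, ∑ y ∈ box d n,
          if (zdGraph d).Adj x y then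
            (twoPointFree d β x - twoPointFree d β (dirRefl δ n x)) * twoPointFree d β (dirRefl δ n y - y)
          else 0))) :=
    tendsto_finsetSum _ fun δ _ => (hT0 _).add
      ((tendsto_finsetSum _ fun x _ => tendsto_finsetSum _ fun y _ => hterm δ x y).const_mul w)
  exact ge_of_tendsto hsum (Filter.eventually_atTop.2 ⟨2 * n, hk⟩)

/-! ### Symmetry: all `2d` directions contribute the same -/

/-- The sign of a direction as a unit. [folklore] -/
theorem coe_ite_units (b : Bool) : (((if b then (1 : ℤˣ) else -1 : ℤˣ)) : ℤ) = sgn b := by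
  cases b <;> simp [sgn]

/-- **Conjugating the reflections**: the signed permutation `τ_δ` which swaps the coordinates
`i₀` and `j` and gives the new `j`-th coordinate the sign of `δ = (j, ±)` carries the reflection
`𝓡_n(+e_{i₀})` to `𝓡_n(δ)`: `𝓡_n(δ) ∘ τ_δ = τ_δ ∘ 𝓡_n(+e_{i₀})` ("the symmetries of `𝐏^∅_β`",
Duminil-Copin–Panis 2025, proof of Lemma 2.4). [cite: DuminilCopinPanis2025LowerBounds, §2.2, proof of Lemma 2.4 (eq. (2.11))] -/
theorem dirRefl_signedPerm (i₀ : Fin d) (δ : Fin d × Bool) (n : ℤ) (x : Site d) :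
    dirRefl δ n (Site.signedPerm (Equiv.swap i₀ δ.1) (Function.update 1 δ.1 (if δ.2 then 1 else -1)) x) =
      Site.signedPerm (Equiv.swap i₀ δ.1) (Function.update 1 δ.1 (if δ.2 then 1 else -1))
        (dirRefl (i₀, true) n x) := by
  obtain ⟨j, b⟩ := δ
  funext i
  simp only [dirRefl_apply, Site.signedPerm_apply, Equiv.symm_swap]
  by_cases hi : i = j
  · subst hi
    rw [if_pos rfl, Function.update_self, Equiv.swap_apply_right, if_pos rfl, coe_ite_units]
    simp only [sgn_true, one_mul]
    ring
  · have hne : Equiv.swap i₀ j i ≠ i₀ := by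
      rw [Ne, Equiv.swap_apply_eq_iff, Equiv.swap_apply_left]
      exact hi
    rw [if_neg hi, Function.update_of_ne hi, if_neg hne]

/-- **The head term is the same in every direction**: `⟨σ₀σ_{𝓡_n(δ)(0)}⟩_β = ⟨σ₀σ_{2ne_{i₀}}⟩_β`
(hyperoctahedral invariance of the free two-point function, `twoPointFree_signedPerm`). [cite: FriedliVelenik2017, Exercise 3.14, p. 115] -/
theorem direction_head_eq (β : ℝ) (i₀ : Fin d) (δ : Fin d × Bool) (n : ℤ) :
    twoPointFree d β (dirRefl δ n 0) = twoPointFree d β (dirRefl (i₀, true) n 0) := by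
  set τ : Site d ≃ Site d :=
    Site.signedPerm (Equiv.swap i₀ δ.1) (Function.update 1 δ.1 (if δ.2 then 1 else -1)) with hτ
  calc twoPointFree d β (dirRefl δ n 0)
      = twoPointFree d β (dirRefl δ n (τ 0)) := by rw [hτ, Site.signedPerm_zero]
    _ = twoPointFree d β (τ (dirRefl (i₀, true) n 0)) := by rw [hτ, dirRefl_signedPerm]
    _ = twoPointFree d β (dirRefl (i₀, true) n 0) := by rw [hτ, twoPointFree_signedPerm]

/-- **The reflected-gradient sum is the same in every direction**:
`Σ_{x,y ∈ Λ_n, y∼x} (⟨σ₀σ_x⟩ - ⟨σ₀σ_{𝓡_n(δ)x}⟩)⟨σ₀σ_{𝓡_n(δ)y - y}⟩` does not depend on `δ` — change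
variables by `τ_δ` (a symmetry of `Λ_n`, of the graph `ℤ^d` and of `⟨σ₀σ_·⟩_β`, conjugating the
reflections; "the symmetries of `𝐏^∅_β`", proof of Lemma 2.4 and the sentence before Lemma 2.5).
[cite: DuminilCopinPanis2025LowerBounds, §2.2, proof of Lemma 2.4 and eq. (2.8)] -/
theorem direction_sum_eq (β : ℝ) (i₀ : Fin d) (δ : Fin d × Bool) (n : ℕ) :
    ∑ x ∈ box d n, ∑ y ∈ box d n, (if (zdGraph d).Adj x y then
        (twoPointFree d β x - twoPointFree d β (dirRefl δ n x)) * twoPointFree d β (dirRefl δ n y - y) else 0) =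
    ∑ x ∈ box d n, ∑ y ∈ box d n, (if (zdGraph d).Adj x y then
        (twoPointFree d β x - twoPointFree d β (dirRefl (i₀, true) n x)) *
          twoPointFree d β (dirRefl (i₀, true) n y - y) else 0) := by
  classical
  set τ : Site d ≃ Site d :=
    Site.signedPerm (Equiv.swap i₀ δ.1) (Function.update 1 δ.1 (if δ.2 then 1 else -1)) with hτ
  have hbox : ∀ z, z ∈ box d n ↔ τ z ∈ box d n := fun z => (Percolation.signedPerm_mem_box_iff _ _).symm
  have hadj : ∀ x y, (zdGraph d).Adj (τ x) (τ y) ↔ (zdGraph d).Adj x y := fun x y =>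
    (Percolation.zdSignedPermIso (Equiv.swap i₀ δ.1) (Function.update 1 δ.1 (if δ.2 then 1 else -1))).map_adj_iff
  have hG : ∀ z, twoPointFree d β (τ z) = twoPointFree d β z := fun z => twoPointFree_signedPerm β _ _ z
  have hR : ∀ z : Site d, dirRefl δ n (τ z) = τ (dirRefl (i₀, true) n z) := fun z => dirRefl_signedPerm i₀ δ n z
  have hsub : ∀ a b, τ (a - b) = τ a - τ b := fun a b => by
    rw [hτ]
    funext i
    simp [mul_sub]
  symm
  refine Finset.sum_equiv τ (fun z => hbox z) fun x _ => ?_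
  refine Finset.sum_equiv τ (fun z => hbox z) fun y _ => ?_
  by_cases hxy : (zdGraph d).Adj x y
  · rw [if_pos hxy, if_pos ((hadj x y).2 hxy), hR, hR, hG, ← hsub, hG, hG]
  · rw [if_neg hxy, if_neg (mt (hadj x y).1 hxy)]

/-- **Sum over the `2d` directions** (the factor `2d` of eq. (2.8) / Lemma 2.4): the direction
terms are all equal to the one of `+e_{i₀}`. [cite: DuminilCopinPanis2025LowerBounds, §2.2, eqs. (2.8) and (2.11)] -/
theorem direction_sum_const (β w : ℝ) (i₀ : Fin d) (n : ℕ) :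
    ∑ δ : Fin d × Bool, (twoPointFree d β (dirRefl δ n 0) +
      w * ∑ x ∈ box d n, ∑ y ∈ box d n,
        if (zdGraph d).Adj x y then
          (twoPointFree d β x - twoPointFree d β (dirRefl δ n x)) * twoPointFree d β (dirRefl δ n y - y)
        else 0) =
    (2 * d : ℝ) * (twoPointFree d β (dirRefl (i₀, true) n 0) +
      w * ∑ x ∈ box d n, ∑ y ∈ box d n,
        if (zdGraph d).Adj x y then
          (twoPointFree d β x - twoPointFree d β (dirRefl (i₀, true) n x)) *
            twoPointFree d β (dirRefl (i₀, true) n y - y)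
        else 0) := by
  rw [Finset.sum_congr rfl fun δ _ => by rw [direction_head_eq β i₀ δ n, direction_sum_eq β i₀ δ n],
    Finset.sum_const, Finset.card_univ, Fintype.card_prod, Fintype.card_fin, Fintype.card_bool, nsmul_eq_mul]
  push_cast
  ring

/-- The direction `+e_i` reflection is the reflection `𝓡_n` of `CriticalTwoPointDCPLower.lean`. [cite: DuminilCopinPanis2025LowerBounds, §1.1 (definition of 𝓡_n)] -/
theorem dirRefl_true_eq_dcpReflect (i : Fin d) (n : ℤ) (z : Site d) :
    dirRefl (i, true) n z = dcpReflect i n z := by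
  unfold dirRefl dcpReflect
  simp

/-! ### Theorem 1.2 in the near-critical range, and Theorem 1.3 -/

open Classical in
open scoped ENNReal symmDiff in
/-- **Duminil-Copin–Panis 2025, Theorem 1.2 for `β ≤ β_c`, `N₀ ≤ n ≤ L(β)`, modulo Lemma 2.5.**
Printed: "Let `d ≥ 3`. There exist `c₀, N₀ > 0` such that for all `β ≤ β_c` and for all
`N₀ ≤ n ≤ L(β)`, `β Σ_{x,y ∈ Λ_n, y ∼ x} (⟨τ₀τ_x⟩_β - ⟨τ₀τ_{𝓡_n(x)}⟩_β)⟨τ_yτ_{𝓡_n(y)}⟩_β ≥ c₀`."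
Here for the nearest-neighbour Ising model, free state, `0 ≤ β ≤ β_c`, `(n : ℕ∞) ≤ L(β)`, in the
rendering of the tree's `β_c` fact `dcp_reflectedGradient_lower` (hypothesis `h12` of
`dcp_twoPoint_axis_lower_of_reflectedGradient_nearCritical`), with `c₀ = 1/(8d)`; the hypothesis
is Lemma 2.5 in per-pair current form on the even tori (the hypothesis `H25` of
`DCPLower.torusIneq_of_lemma25`, for all `0 ≤ β ≤ β_c`, `n ≥ 1`, even `L ≥ 4n + 2`). Proof (§2.2):
the infinite-volume inequality with the sharp-length input `w = 2β` (eq. (2.5), valid because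
`n ≤ L(β)`), the symmetry over the `2d` directions, and Lemma 2.4: by the infrared bound for
`β ≤ β_c`, `2d ⟨σ₀σ_{2ne₁}⟩_β ≤ 2d C₀/(2n) ≤ 1/2` for `n ≥ N₀ = max(2, ⌈2dC₀⌉)`, whence
`4dβ Σ ≥ 1/2`. [cite: DuminilCopinPanis2025LowerBounds, Theorem 1.2 and §2.2 (Lemma 2.4, eqs. (2.5)–(2.8))] -/
theorem reflectedGradient_nearCritical_of_lemma25
    (H25 : ∀ (β : ℝ), 0 ≤ β → β ≤ criticalBeta d → ∀ (n : ℕ) (hn : 1 ≤ n)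
      (L : ℕ) [NeZero L] (hL : Even L) (hnL : 4 * n + 2 ≤ L),
      ∀ δ : Fin d × Bool, ∀ x ∈ box d n, ∀ y ∈ box d n, (zdGraph d).Adj x y →
      ∑' nc : edgesIn (torusGraph d L) univ → ℕ,
        ind (csources (torusGraph d L) univ nc = ∅ ∧ CSupp (torusGraph d L) univ (edgesIn (torusGraph d L) univ) nc) *
          cweight (torusGraph d L) univ β nc *
          (ind (¬ (isFoldable_dir hL (by omega) n δ).ConnFix ((isFoldable_dir hL (by omega) n δ).fold nc) (Torus.proj L 0) ∧
                ¬ (isFoldable_dir hL (by omega) n δ).ConnFix ((isFoldable_dir hL (by omega) n δ).fold nc) (Torus.proj L x) ∧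
                (isFoldable_dir hL (by omega) n δ).ConnFix ((isFoldable_dir hL (by omega) n δ).fold nc) (Torus.proj L y)) *
            ENNReal.ofReal (isingTwoPoint (torusGraph d L)
              (((box d n).filter fun z => ¬ (isFoldable_dir hL (by omega) n δ).ConnFix
                  ((isFoldable_dir hL (by omega) n δ).fold nc) (Torus.proj L z)).image (Torus.proj L))
              β 0 .free (Torus.proj L 0) (Torus.proj L x))) ≤
        (currentZ (torusGraph d L) univ β (edgesIn (torusGraph d L) univ) ({Torus.proj L 0} ∆ {Torus.proj L x}) -
            currentZ (torusGraph d L) univ β (edgesIn (torusGraph d L) univ)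
              ({Torus.proj L 0} ∆ {dirTheta L n δ (Torus.proj L x)})) *
          ENNReal.ofReal (isingTwoPoint (torusGraph d L) univ β 0 .free (Torus.proj L y) (dirTheta L n δ (Torus.proj L y)))) :
    ∀ (hd : 3 ≤ d), ∃ c₀ : ℝ, 0 < c₀ ∧ ∃ N₀ : ℕ, 0 < N₀ ∧ ∀ β : ℝ, 0 ≤ β →
      β ≤ criticalBeta d → ∀ n : ℕ, N₀ ≤ n → (n : ℕ∞) ≤ sharpLength d β →
        c₀ ≤ β * ∑ x ∈ box d n, ∑ y ∈ box d n,
          if (zdGraph d).Adj x y then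
            (twoPointFree d β x - twoPointFree d β (dcpReflect (⟨0, by omega⟩ : Fin d) (n : ℤ) x)) *
              freeExpect d β 0 (spinPair y (dcpReflect (⟨0, by omega⟩ : Fin d) (n : ℤ) y))
          else 0 := by
  intro hd
  have hd0 : 0 < d := by omega
  have hdpos : (0 : ℝ) < d := by exact_mod_cast hd0
  set i₀ : Fin d := ⟨0, hd0⟩ with hi₀
  obtain ⟨C₀, hC₀, hIR⟩ := twoPointFree_le_of_le_criticalBeta (d := d) hd
  obtain ⟨N₀, hN₀2, hN₀C⟩ : ∃ N₀ : ℕ, 2 ≤ N₀ ∧ C₀ * (2 * d) ≤ N₀ :=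
    ⟨max 2 ⌈C₀ * (2 * d)⌉₊, le_max_left _ _,
      (Nat.le_ceil _).trans (by exact_mod_cast le_max_right 2 ⌈C₀ * (2 * (d : ℝ))⌉₊)⟩
  refine ⟨1 / (8 * d), by positivity, N₀, by omega, fun β hβ hβc n hn hnL => ?_⟩
  have hn2 : 2 ≤ n := hN₀2.trans hn
  have hnpos : (0 : ℝ) < n := by exact_mod_cast (show 0 < n by omega)
  have hm : spontaneousMagnetization d β = 0 := spontaneousMagnetization_eq_zero_of_le_criticalBeta hd hβ hβc
  -- the infinite-volume inequality with `w = 2β`, summed over the directions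
  have hineq := infiniteVolume_ineq_of_lemma25 hβ hm (by omega : 1 ≤ n) (by positivity : (0 : ℝ) ≤ 2 * β)
    (sharpLength_input hn2 hnL) (fun L _ hL hnL' => H25 β hβ hβc n (by omega) L hL hnL')
  rw [direction_sum_const β (2 * β) i₀ n] at hineq
  -- Lemma 2.4: the head term is small by the infrared bound
  set x₀ : Site d := dirRefl (i₀, true) (n : ℤ) 0 with hx₀
  have hx₀i : x₀ i₀ = 2 * n := by
    rw [hx₀, dirRefl_apply, if_pos rfl]
    simp
  have hnorm : (2 * n : ℝ) ≤ ‖x₀‖ := by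
    have h1 : ‖x₀ i₀‖ ≤ ‖x₀‖ := norm_le_pi_norm x₀ i₀
    rw [hx₀i, Int.norm_eq_abs] at h1
    push_cast at h1
    rw [abs_of_nonneg (by positivity)] at h1
    exact h1
  have hx₀ne : x₀ ≠ 0 := by
    intro h
    have := congrFun h i₀
    rw [hx₀i] at this
    simp at this
    omega
  have hnormpos : (0 : ℝ) < ‖x₀‖ := lt_of_lt_of_le (by positivity) hnorm
  have hGsmall : twoPointFree d β x₀ ≤ 1 / (4 * d) := by
    have h1 := hIR β hβ hβc x₀ hx₀ne
    have hinv1 : 1 / ‖x₀‖ ≤ 1 := by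
      rw [div_le_one hnormpos]
      exact le_trans (by norm_cast; omega) hnorm
    have hpow : (1 / ‖x₀‖) ^ (d - 2) ≤ 1 / ‖x₀‖ :=
      pow_le_of_le_one (by positivity) hinv1 (by omega)
    have hinv2 : 1 / ‖x₀‖ ≤ 1 / (2 * n) := one_div_le_one_div_of_le (by positivity) hnorm
    have hC : C₀ * (1 / (2 * n)) ≤ 1 / (4 * d) := by
      rw [mul_one_div, div_le_div_iff₀ (by positivity) (by positivity)]
      have : (N₀ : ℝ) ≤ n := by exact_mod_cast hn
      nlinarith
    calc twoPointFree d β x₀ ≤ C₀ * (1 / ‖x₀‖) ^ (d - 2) := h1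
      _ ≤ C₀ * (1 / ‖x₀‖) := mul_le_mul_of_nonneg_left hpow hC₀.le
      _ ≤ C₀ * (1 / (2 * n)) := mul_le_mul_of_nonneg_left hinv2 hC₀.le
      _ ≤ 1 / (4 * d) := hC
  -- identify the sum with the printed one
  have hS : ∑ x ∈ box d n, ∑ y ∈ box d n,
      (if (zdGraph d).Adj x y then
        (twoPointFree d β x - twoPointFree d β (dirRefl (i₀, true) n x)) *
          twoPointFree d β (dirRefl (i₀, true) n y - y) else 0) =
      ∑ x ∈ box d n, ∑ y ∈ box d n,
        (if (zdGraph d).Adj x y then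
          (twoPointFree d β x - twoPointFree d β (dcpReflect i₀ (n : ℤ) x)) *
            freeExpect d β 0 (spinPair y (dcpReflect i₀ (n : ℤ) y)) else 0) := by
    have hfe : ∀ y z : Site d, freeExpect d β 0 (spinPair y z) = twoPointFree d β (z - y) :=
      fun y z => freePair_eq_twoPointFree_sub hβ y z
    refine Finset.sum_congr rfl fun x _ => Finset.sum_congr rfl fun y _ => ?_
    rw [hfe, dirRefl_true_eq_dcpReflect, dirRefl_true_eq_dcpReflect]
  rw [hS] at hineq
  set S := ∑ x ∈ box d n, ∑ y ∈ box d n,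
        (if (zdGraph d).Adj x y then
          (twoPointFree d β x - twoPointFree d β (dcpReflect i₀ (n : ℤ) x)) *
            freeExpect d β 0 (spinPair y (dcpReflect i₀ (n : ℤ) y)) else 0) with hSdef
  -- conclude: `1 ≤ 2d (G(x₀) + 2β S)` and `2d G(x₀) ≤ 1/2`
  have h2 : 2 * (d : ℝ) * twoPointFree d β x₀ ≤ 1 / 2 := by
    calc 2 * (d : ℝ) * twoPointFree d β x₀ ≤ 2 * d * (1 / (4 * d)) :=
          mul_le_mul_of_nonneg_left hGsmall (by positivity)
      _ = 1 / 2 := by field_simp; ring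
  have h3 : 1 / 2 ≤ 4 * d * (β * S) := by nlinarith [hineq, h2]
  rw [show (1 : ℝ) / (8 * d) = 1 / 2 / (4 * d) by field_simp; ring, div_le_iff₀ (by positivity)]
  linarith

open Classical in
open scoped ENNReal symmDiff in
/-- **Duminil-Copin–Panis 2025, Theorem 1.3 in the near-critical range, modulo Lemma 2.5**: the
named fact `dcp_twoPoint_axis_lower_nearCritical` (`0 ≤ β ≤ β_c`, `N₁ ≤ n`, `4n ≤ L(β)`) follows
from Theorem 1.2 in the near-critical range (`reflectedGradient_nearCritical_of_lemma25`) by the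
landed deduction "Theorem 1.2 at scale `4n` ⟹ Theorem 1.3 at scale `n`"
(`dcp_twoPoint_axis_lower_of_reflectedGradient_nearCritical`). [cite: DuminilCopinPanis2025LowerBounds, Theorem 1.3 (proof, end of §1.1) with Theorem 1.2] -/
theorem dcp_twoPoint_axis_lower_nearCritical_of_lemma25
    (H25 : ∀ (β : ℝ), 0 ≤ β → β ≤ criticalBeta d → ∀ (n : ℕ) (hn : 1 ≤ n)
      (L : ℕ) [NeZero L] (hL : Even L) (hnL : 4 * n + 2 ≤ L),
      ∀ δ : Fin d × Bool, ∀ x ∈ box d n, ∀ y ∈ box d n, (zdGraph d).Adj x y →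
      ∑' nc : edgesIn (torusGraph d L) univ → ℕ,
        ind (csources (torusGraph d L) univ nc = ∅ ∧ CSupp (torusGraph d L) univ (edgesIn (torusGraph d L) univ) nc) *
          cweight (torusGraph d L) univ β nc *
          (ind (¬ (isFoldable_dir hL (by omega) n δ).ConnFix ((isFoldable_dir hL (by omega) n δ).fold nc) (Torus.proj L 0) ∧
                ¬ (isFoldable_dir hL (by omega) n δ).ConnFix ((isFoldable_dir hL (by omega) n δ).fold nc) (Torus.proj L x) ∧
                (isFoldable_dir hL (by omega) n δ).ConnFix ((isFoldable_dir hL (by omega) n δ).fold nc) (Torus.proj L y)) *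
            ENNReal.ofReal (isingTwoPoint (torusGraph d L)
              (((box d n).filter fun z => ¬ (isFoldable_dir hL (by omega) n δ).ConnFix
                  ((isFoldable_dir hL (by omega) n δ).fold nc) (Torus.proj L z)).image (Torus.proj L))
              β 0 .free (Torus.proj L 0) (Torus.proj L x))) ≤
        (currentZ (torusGraph d L) univ β (edgesIn (torusGraph d L) univ) ({Torus.proj L 0} ∆ {Torus.proj L x}) -
            currentZ (torusGraph d L) univ β (edgesIn (torusGraph d L) univ)
              ({Torus.proj L 0} ∆ {dirTheta L n δ (Torus.proj L x)})) *
          ENNReal.ofReal (isingTwoPoint (torusGraph d L) univ β 0 .free (Torus.proj L y) (dirTheta L n δ (Torus.proj L y)))) :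
    dcp_twoPoint_axis_lower_nearCritical (d := d) :=
  dcp_twoPoint_axis_lower_of_reflectedGradient_nearCritical (reflectedGradient_nearCritical_of_lemma25 H25)

open Classical in
open scoped ENNReal symmDiff in
/-- **The `β_c` facts, modulo Lemma 2.5**: Theorem 1.2 in the near-critical range specialises at
`β = β_c` (`L(β_c) = ∞`) to `dcp_reflectedGradient_lower`, and Theorem 1.3 to
`dcp_criticalTwoPoint_axis_lower` (`dcp_reflectedGradient_lower_of_nearCritical`,
`dcp_criticalTwoPoint_axis_lower_of_reflectedGradient_nearCritical`). [cite: DuminilCopinPanis2025LowerBounds, Theorems 1.2–1.3 at β_c] -/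
theorem dcp_critical_of_lemma25
    (H25 : ∀ (β : ℝ), 0 ≤ β → β ≤ criticalBeta d → ∀ (n : ℕ) (hn : 1 ≤ n)
      (L : ℕ) [NeZero L] (hL : Even L) (hnL : 4 * n + 2 ≤ L),
      ∀ δ : Fin d × Bool, ∀ x ∈ box d n, ∀ y ∈ box d n, (zdGraph d).Adj x y →
      ∑' nc : edgesIn (torusGraph d L) univ → ℕ,
        ind (csources (torusGraph d L) univ nc = ∅ ∧ CSupp (torusGraph d L) univ (edgesIn (torusGraph d L) univ) nc) *
          cweight (torusGraph d L) univ β nc *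
          (ind (¬ (isFoldable_dir hL (by omega) n δ).ConnFix ((isFoldable_dir hL (by omega) n δ).fold nc) (Torus.proj L 0) ∧
                ¬ (isFoldable_dir hL (by omega) n δ).ConnFix ((isFoldable_dir hL (by omega) n δ).fold nc) (Torus.proj L x) ∧
                (isFoldable_dir hL (by omega) n δ).ConnFix ((isFoldable_dir hL (by omega) n δ).fold nc) (Torus.proj L y)) *
            ENNReal.ofReal (isingTwoPoint (torusGraph d L)
              (((box d n).filter fun z => ¬ (isFoldable_dir hL (by omega) n δ).ConnFix
                  ((isFoldable_dir hL (by omega) n δ).fold nc) (Torus.proj L z)).image (Torus.proj L))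
              β 0 .free (Torus.proj L 0) (Torus.proj L x))) ≤
        (currentZ (torusGraph d L) univ β (edgesIn (torusGraph d L) univ) ({Torus.proj L 0} ∆ {Torus.proj L x}) -
            currentZ (torusGraph d L) univ β (edgesIn (torusGraph d L) univ)
              ({Torus.proj L 0} ∆ {dirTheta L n δ (Torus.proj L x)})) *
          ENNReal.ofReal (isingTwoPoint (torusGraph d L) univ β 0 .free (Torus.proj L y) (dirTheta L n δ (Torus.proj L y)))) :
    dcp_reflectedGradient_lower (d := d) ∧ dcp_criticalTwoPoint_axis_lower (d := d) :=
  ⟨dcp_reflectedGradient_lower_of_nearCritical (reflectedGradient_nearCritical_of_lemma25 H25),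
    dcp_criticalTwoPoint_axis_lower_of_reflectedGradient_nearCritical (reflectedGradient_nearCritical_of_lemma25 H25)⟩

/-! ### Lemma 2.5 on the even torus, and the discharge -/

open Classical in
open scoped ENNReal symmDiff in
/-- **Lemma 2.5 of Duminil-Copin–Panis 2025 on the even torus** (the hypothesis `H25`, for every
`β ≥ 0`, `n ≥ 1`, even `L ≥ 4n + 2`, direction `δ` and neighbours `x, y ∈ Λ_n`): the tree's
`IsFoldable.lemma25` (`CriticalTwoPointDCPLowerLemma25.lean`: Griffiths `𝒮¹_n ⊆ 𝒢_n`, the Markov step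
on `𝒢_n`, conditioning on `𝒞_n(0)`, outer switching) for the direction fold datum `isFoldable_dir`
with candidate region `B = Λ̄_n` (box points lie in `H_δ ∪ Fix`, `proj_mem_dirHalf_or_fixed`), when
`x̄ ∈ H_δ`; when `x̄` is on the hyperplane it is connected to `ℍ_δ` in every folded current
(`IsFoldable.connFix_of_fixed`) and the left side vanishes. [cite: DuminilCopinPanis2025LowerBounds, Lemma 2.5] -/
theorem lemma25_torus {β : ℝ} (hβ : 0 ≤ β) {n : ℕ} (hn : 1 ≤ n) {L : ℕ} [NeZero L] (hL : Even L)
    (hnL : 4 * n + 2 ≤ L) :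
    ∀ δ : Fin d × Bool, ∀ x ∈ box d n, ∀ y ∈ box d n, (zdGraph d).Adj x y →
      ∑' nc : edgesIn (torusGraph d L) univ → ℕ,
        ind (csources (torusGraph d L) univ nc = ∅ ∧ CSupp (torusGraph d L) univ (edgesIn (torusGraph d L) univ) nc) *
          cweight (torusGraph d L) univ β nc *
          (ind (¬ (isFoldable_dir hL (by omega) n δ).ConnFix ((isFoldable_dir hL (by omega) n δ).fold nc) (Torus.proj L 0) ∧
                ¬ (isFoldable_dir hL (by omega) n δ).ConnFix ((isFoldable_dir hL (by omega) n δ).fold nc) (Torus.proj L x) ∧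
                (isFoldable_dir hL (by omega) n δ).ConnFix ((isFoldable_dir hL (by omega) n δ).fold nc) (Torus.proj L y)) *
            ENNReal.ofReal (isingTwoPoint (torusGraph d L)
              (((box d n).filter fun z => ¬ (isFoldable_dir hL (by omega) n δ).ConnFix
                  ((isFoldable_dir hL (by omega) n δ).fold nc) (Torus.proj L z)).image (Torus.proj L))
              β 0 .free (Torus.proj L 0) (Torus.proj L x))) ≤
        (currentZ (torusGraph d L) univ β (edgesIn (torusGraph d L) univ) ({Torus.proj L 0} ∆ {Torus.proj L x}) -
            currentZ (torusGraph d L) univ β (edgesIn (torusGraph d L) univ)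
              ({Torus.proj L 0} ∆ {dirTheta L n δ (Torus.proj L x)})) *
          ENNReal.ofReal (isingTwoPoint (torusGraph d L) univ β 0 .free (Torus.proj L y) (dirTheta L n δ (Torus.proj L y))) := by
  intro δ x hx y hy _
  have hD : IsFoldable (torusGraph d L) (dirTheta L n δ) univ (dirHalf L n δ) := isFoldable_dir hL (by omega) n δ
  rcases proj_mem_dirHalf_or_fixed hL hnL hx δ with hxH | hxfix
  · have key := hD.lemma25 hβ (B := (box d n).image (Torus.proj L)) (Finset.subset_univ _)
      (fun v hv => by
        obtain ⟨z, hz, rfl⟩ := Finset.mem_image.1 hv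
        exact proj_mem_dirHalf_or_fixed hL hnL hz δ)
      (proj_zero_mem_dirHalf hL hn hnL δ) hxH (Finset.mem_image_of_mem _ (zero_mem_box d n))
      (Finset.mem_image_of_mem _ hx) (Finset.mem_univ _) (proj_mem_dirHalf_or_fixed hL hnL hy δ)
    simpa only [Finset.filter_image] using key
  · refine le_of_eq_of_le (ENNReal.tsum_eq_zero.2 fun nc => ?_) bot_le
    have hcx : (isFoldable_dir hL (by omega) n δ).ConnFix ((isFoldable_dir hL (by omega) n δ).fold nc) (Torus.proj L x) :=
      (isFoldable_dir hL (by omega) n δ).connFix_of_fixed _ (Finset.mem_univ _) hxfix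
    have hz : ind (¬ (isFoldable_dir hL (by omega) n δ).ConnFix ((isFoldable_dir hL (by omega) n δ).fold nc) (Torus.proj L 0) ∧
        ¬ (isFoldable_dir hL (by omega) n δ).ConnFix ((isFoldable_dir hL (by omega) n δ).fold nc) (Torus.proj L x) ∧
        (isFoldable_dir hL (by omega) n δ).ConnFix ((isFoldable_dir hL (by omega) n δ).fold nc) (Torus.proj L y)) = 0 :=
      ind_of_false fun h => h.2.1 hcx
    rw [hz, zero_mul, mul_zero]

/-- **Theorems 1.2 and 1.3 at `β_c`, proved** (consistency corollary: the `β_c` named facts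
`dcp_reflectedGradient_lower` and `dcp_criticalTwoPoint_axis_lower` of `CriticalTwoPointDCPLower.lean`
follow from the near-critical Theorem 1.2 with Lemma 2.5 on the torus). [cite: DuminilCopinPanis2025LowerBounds, Theorems 1.2–1.3 at β_c] -/
theorem dcp_critical_holds :
    dcp_reflectedGradient_lower (d := d) ∧ dcp_criticalTwoPoint_axis_lower (d := d) :=
  dcp_critical_of_lemma25 fun _ hβ _ _ hn _ _ hL hnL => lemma25_torus (d := d) hβ hn hL hnL

end DCPNearCritical

variable {d : ℕ}

/-- **Duminil-Copin–Panis 2025, Theorem 1.3 in the near-critical range — discharge of the named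
fact `dcp_twoPoint_axis_lower_nearCritical`** (`d ≥ 3`, `0 ≤ β ≤ β_c`, `N₁ ≤ n`, `4n ≤ L(β)`:
`⟨σ₀σ_{ne₁}⟩_β ≥ c₁ / (χ_{4n}(β) + n^{d-2} Σ_{k ≤ 2n} k⟨σ₀σ_{ke₁}⟩_β)`): Theorem 1.2 in the
near-critical range on the torus route (`DCPNearCritical.reflectedGradient_nearCritical_of_lemma25`
with `DCPNearCritical.lemma25_torus`) and the printed deduction of Theorem 1.3 from Theorem 1.2 at
scale `4n` (`dcp_twoPoint_axis_lower_of_reflectedGradient_nearCritical`). [cite: DuminilCopinPanis2025LowerBounds, Theorem 1.3 with Theorem 1.2 and §2.2] -/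
theorem dcp_twoPoint_axis_lower_nearCritical_holds : dcp_twoPoint_axis_lower_nearCritical (d := d) :=
  DCPNearCritical.dcp_twoPoint_axis_lower_nearCritical_of_lemma25
    fun _ hβ _ _ hn _ _ hL hnL => DCPNearCritical.lemma25_torus (d := d) hβ hn hL hnL

end Literature.Probability.LatticeModels

end
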